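import Summits.Schanuel.Schanuel.Theorems.SoloInformedPointwiseTransfer

/-!
# X193 kernel, layer B (F10a): Roy's Proposition 3.1 at `t = 1` on the columns `k ξ`

Solo-informed Schanuel programme, X193 kernel (DESIGN `work/s213/X193-KERNEL-DESIGN.md`,
Amendment A14).  This file prices the resultant inequality that feeds the laws (PAIR) and
(L1) of `SoloServiceData` (F2, `SoloInformedX193Laws`), CONDITIONALLY on the named fact
`Literature.NumberTheory.Transcendental.Roy2010.prop_3_1` (D. Roy, *Small value estimates
for the additive group*, Int. J. Number Theory 6 (2010), Proposition 3.1), used only at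
`t = 1` (no derivatives):

* primitive parts only shrink heights and values (`soloX_supNorm_primPart_le`,
  `soloX_norm_aeval_primPart_le`);
* for the columns `E = {k ξ : k ∈ S}`, `S ⊆ [0, K]`, `ξ ≠ 0`: `c_E ≤ K ‖ξ‖`,
  `-log Δ_E ≤ |S|² max (0, -log ‖ξ‖)`, hence the error term
  `log c₁ (n, |S|, 1, E) ≤ A(ξ) n² log (K + 2)` with the explicit constant
  `A(ξ) = 11 + 4 log (1 + ‖ξ‖) + max (0, -log ‖ξ‖)` (`soloX_log_c₁_cols_le`);
* the core lemma `soloX_p31_coprime`: for a coprime pair of primitive polynomials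
  Proposition 3.1 at `t = 1` reads `1 ≤ c₁ ‖F‖^{deg G} ‖G‖^{deg F} ∏_{z ∈ E} V z`.

Reused from `SoloInformedPointwiseTransfer`: `soloPT_card_image`, `soloPT_cMax_image_le`,
`soloPT_cMax_nonneg`, `soloPT_pow_le_deltaCap_image`.  No new definitions; the constant `A(ξ)`
is always written out literally.
-/

namespace Summit.Schanuel.Schanuel.Theorems

open Polynomial UniqueFactorizationMonoid Finset
open Literature.NumberTheory.Transcendental.Roy2010

/-! ## Primitive parts: heights and values only shrink -/

/-- The content of a nonzero integer polynomial has absolute value `≥ 1`. -/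
theorem soloX_one_le_abs_content {x : ℤ[X]} (hx : x ≠ 0) :
    (1 : ℝ) ≤ |(x.content : ℝ)| := by
  have h : x.content ≠ 0 := fun h => hx (content_eq_zero_iff.mp h)
  exact_mod_cast Int.one_le_abs h

/-- `‖primPart x‖_∞ ≤ ‖x‖_∞` for a nonzero integer polynomial (`x = c · primPart x`
with `|c| ≥ 1`). -/
theorem soloX_supNorm_primPart_le {x : ℤ[X]} (hx : x ≠ 0) :
    x.primPart.supNorm ≤ x.supNorm := by
  obtain ⟨i, hi⟩ := exists_eq_supNorm x.primPart
  have hc : (1 : ℝ) ≤ |(x.content : ℝ)| := soloX_one_le_abs_content hx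
  have hcoeff : x.coeff i = x.content * x.primPart.coeff i := by
    conv_lhs => rw [eq_C_content_mul_primPart x]
    rw [coeff_C_mul]
  have h1 : ‖x.coeff i‖ = |(x.content : ℝ)| * ‖x.primPart.coeff i‖ := by
    rw [hcoeff, Int.norm_eq_abs, Int.norm_eq_abs, Int.cast_mul, abs_mul]
  calc x.primPart.supNorm = ‖x.primPart.coeff i‖ := hi
    _ ≤ |(x.content : ℝ)| * ‖x.primPart.coeff i‖ :=
        le_mul_of_one_le_left (norm_nonneg _) hc
    _ = ‖x.coeff i‖ := h1.symm
    _ ≤ x.supNorm := le_supNorm x i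

/-- `‖(primPart x)(z)‖ ≤ ‖x(z)‖` for a nonzero integer polynomial and any complex `z`. -/
theorem soloX_norm_aeval_primPart_le {x : ℤ[X]} (hx : x ≠ 0) (z : ℂ) :
    ‖aeval z x.primPart‖ ≤ ‖aeval z x‖ := by
  have hc : (1 : ℝ) ≤ |(x.content : ℝ)| := soloX_one_le_abs_content hx
  have h1 : aeval z x = (x.content : ℂ) * aeval z x.primPart := by
    conv_lhs => rw [eq_C_content_mul_primPart x]
    rw [map_mul, aeval_C, eq_intCast]
  rw [h1, norm_mul, Complex.norm_intCast]
  exact le_mul_of_one_le_left (norm_nonneg _) hc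

/-! ## The columns `k ξ` as a finite set of complex points -/

/-- `k ↦ k ξ` is injective on `ℕ` for `ξ ≠ 0`. -/
theorem soloX_col_injective {ξ : ℂ} (hξ : ξ ≠ 0) :
    Function.Injective (fun k : ℕ => (k : ℂ) * ξ) := by
  intro a b h
  have h' : (a : ℂ) = (b : ℂ) := mul_right_cancel₀ hξ h
  exact_mod_cast h'

/-- A sum over the points `k ξ`, `k ∈ S`, is the sum over `S`. -/
theorem soloX_sum_cols {ξ : ℂ} (hξ : ξ ≠ 0) (S : Finset ℕ) (f : ℂ → ℝ) :
    ∑ z ∈ S.image (fun k : ℕ => (k : ℂ) * ξ), f z = ∑ k ∈ S, f ((k : ℂ) * ξ) :=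
  Finset.sum_image (soloX_col_injective hξ).injOn

/-- `Δ_E > 0` for every finite set `E` (a product of square roots of positive distances). -/
theorem soloX_deltaCap_pos (E : Finset ℂ) : 0 < deltaCap E := by
  unfold deltaCap
  refine Finset.prod_pos fun p hp => ?_
  rw [Finset.mem_offDiag] at hp
  exact Real.sqrt_pos.mpr (norm_pos_iff.mpr (sub_ne_zero.mpr hp.2.2))

/-- For the columns of `S`: `-log Δ_E ≤ |S|² · max 0 (-log ‖ξ‖)` (from
`soloPT_pow_le_deltaCap_image`: `Δ_E ≥ min (1, ‖ξ‖) ^ (|S|²)`). -/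
theorem soloX_neg_log_deltaCap_cols_le {ξ : ℂ} (hξ : ξ ≠ 0) (S : Finset ℕ) :
    -Real.log (deltaCap (S.image fun k : ℕ => (k : ℂ) * ξ)) ≤
      (S.card : ℝ) ^ 2 * max 0 (-Real.log ‖ξ‖) := by
  have hm0 : 0 < min 1 ‖ξ‖ := lt_min one_pos (norm_pos_iff.mpr hξ)
  have hlog : Real.log ((min 1 ‖ξ‖) ^ (S.card ^ 2)) ≤
      Real.log (deltaCap (S.image fun k : ℕ => (k : ℂ) * ξ)) :=
    Real.log_le_log (pow_pos hm0 _) (soloPT_pow_le_deltaCap_image hξ S)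
  rw [Real.log_pow] at hlog
  push_cast at hlog
  have hmin : -Real.log (min 1 ‖ξ‖) ≤ max 0 (-Real.log ‖ξ‖) := by
    rcases le_total 1 ‖ξ‖ with h1 | h1
    · rw [min_eq_left h1, Real.log_one, neg_zero]
      exact le_max_left _ _
    · rw [min_eq_right h1]
      exact le_max_right _ _
  have hs : (0 : ℝ) ≤ (S.card : ℝ) ^ 2 := by positivity
  calc -Real.log (deltaCap (S.image fun k : ℕ => (k : ℂ) * ξ))
      ≤ -((S.card : ℝ) ^ 2 * Real.log (min 1 ‖ξ‖)) := by linarith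
    _ = (S.card : ℝ) ^ 2 * (-Real.log (min 1 ‖ξ‖)) := by ring
    _ ≤ (S.card : ℝ) ^ 2 * max 0 (-Real.log ‖ξ‖) := mul_le_mul_of_nonneg_left hmin hs

/-! ## Roy's constant `c₁` at `t = 1` -/

/-- `c₁ (n, s, 1, E) > 0`. -/
theorem soloX_c₁_pos (n s : ℕ) (E : Finset ℂ) : 0 < c₁ n s 1 E := by
  unfold c₁
  have h2 : 0 < 2 + cMax E := by have := soloPT_cMax_nonneg E; linarith
  exact div_pos (mul_pos (Real.exp_pos _) (pow_pos h2 _)) (pow_pos (soloX_deltaCap_pos E) _)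

/-- `log c₁ (n, s, 1, E) = 7 n² + 4 n s · log (2 + c_E) - log Δ_E`. -/
theorem soloX_log_c₁_eq (n s : ℕ) (E : Finset ℂ) :
    Real.log (c₁ n s 1 E) =
      7 * (n : ℝ) ^ 2 + 4 * n * s * Real.log (2 + cMax E) - Real.log (deltaCap E) := by
  unfold c₁
  have h2 : 0 < 2 + cMax E := by have := soloPT_cMax_nonneg E; linarith
  rw [Real.log_div (mul_pos (Real.exp_pos _) (pow_pos h2 _)).ne'
      (pow_pos (soloX_deltaCap_pos E) _).ne',
    Real.log_mul (Real.exp_pos _).ne' (pow_pos h2 _).ne', Real.log_exp, Real.log_pow,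
    Real.log_pow]
  push_cast
  ring

/-- The constant of the laws (PAIR) and (L1),
`A(ξ) = 11 + 4 log (1 + ‖ξ‖) + max 0 (-log ‖ξ‖)`, is non-negative (indeed `≥ 11`). -/
theorem soloX_pairConst_nonneg (ξ : ℂ) :
    0 ≤ 11 + 4 * Real.log (1 + ‖ξ‖) + max 0 (-Real.log ‖ξ‖) := by
  have h1 : 0 ≤ Real.log (1 + ‖ξ‖) := Real.log_nonneg (by have := norm_nonneg ξ; linarith)
  have h2 : 0 ≤ max 0 (-Real.log ‖ξ‖) := le_max_left _ _
  linarith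

/-- `1 ≤ log (K + 2)` for `K ≥ 1` (`K + 2 ≥ 3 > e`). -/
theorem soloX_one_le_log_add_two {K : ℕ} (hK : 1 ≤ K) : 1 ≤ Real.log ((K : ℝ) + 2) := by
  have h3 : (3 : ℝ) ≤ (K : ℝ) + 2 := by
    have : (1 : ℝ) ≤ K := by exact_mod_cast hK
    linarith
  exact (Real.le_log_iff_exp_le (by positivity)).mpr (Real.exp_one_lt_three.le.trans h3)

/-- **The error term at `t = 1`.**  For the columns `E = {kξ : k ∈ S}` with `S ⊆ [0, K]`,
`K ≥ 1`, `ξ ≠ 0` and any `n ≥ |S|`: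
`log c₁ (n, |S|, 1, E) ≤ A(ξ) · n² · log (K + 2)`. -/
theorem soloX_log_c₁_cols_le {ξ : ℂ} (hξ : ξ ≠ 0) {S : Finset ℕ} {K n : ℕ}
    (hK : 1 ≤ K) (hS : ∀ k ∈ S, k ≤ K) (hn : S.card ≤ n) :
    Real.log (c₁ n S.card 1 (S.image fun k : ℕ => (k : ℂ) * ξ)) ≤
      (11 + 4 * Real.log (1 + ‖ξ‖) + max 0 (-Real.log ‖ξ‖)) * (n : ℝ) ^ 2 *
        Real.log ((K : ℝ) + 2) := by
  set E := S.image fun k : ℕ => (k : ℂ) * ξ with hE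
  set M := max 0 (-Real.log ‖ξ‖) with hM
  set L := Real.log ((K : ℝ) + 2) with hL
  set l₁ := Real.log (1 + ‖ξ‖) with hl₁
  have hL1 : 1 ≤ L := soloX_one_le_log_add_two hK
  have hM0 : 0 ≤ M := le_max_left _ _
  have hl₁0 : 0 ≤ l₁ := Real.log_nonneg (by have := norm_nonneg ξ; linarith)
  have hn0 : (0 : ℝ) ≤ n := Nat.cast_nonneg n
  have hsn : (S.card : ℝ) ≤ n := by exact_mod_cast hn
  have hc0 : 0 ≤ cMax E := soloPT_cMax_nonneg E
  have hcK : cMax E ≤ K * ‖ξ‖ := soloPT_cMax_image_le ξ hS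
  have hK0 : (0 : ℝ) ≤ K := Nat.cast_nonneg K
  -- log (2 + c_E) ≤ L + l₁
  have hlog2 : Real.log (2 + cMax E) ≤ L + l₁ := by
    have h1 : 2 + cMax E ≤ ((K : ℝ) + 2) * (1 + ‖ξ‖) := by
      nlinarith [norm_nonneg ξ, mul_nonneg hK0 (norm_nonneg ξ)]
    calc Real.log (2 + cMax E) ≤ Real.log (((K : ℝ) + 2) * (1 + ‖ξ‖)) :=
          Real.log_le_log (by linarith) h1
      _ = L + l₁ := by
          rw [Real.log_mul (by positivity) (by have := norm_nonneg ξ; positivity)]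
  have hlog2' : 0 ≤ Real.log (2 + cMax E) := Real.log_nonneg (by linarith)
  -- the Δ term
  have hdelta : -Real.log (deltaCap E) ≤ (S.card : ℝ) ^ 2 * M :=
    soloX_neg_log_deltaCap_cols_le hξ S
  have hs2 : (S.card : ℝ) ^ 2 * M ≤ (n : ℝ) ^ 2 * M := by
    apply mul_le_mul_of_nonneg_right _ hM0
    exact pow_le_pow_left₀ (Nat.cast_nonneg _) hsn 2
  -- assemble
  rw [soloX_log_c₁_eq]
  have h4 : 4 * (n : ℝ) * S.card * Real.log (2 + cMax E) ≤ 4 * (n : ℝ) ^ 2 * (L + l₁) := by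
    have ha : 4 * (n : ℝ) * S.card ≤ 4 * (n : ℝ) ^ 2 := by nlinarith
    calc 4 * (n : ℝ) * S.card * Real.log (2 + cMax E)
        ≤ 4 * (n : ℝ) ^ 2 * Real.log (2 + cMax E) := mul_le_mul_of_nonneg_right ha hlog2'
      _ ≤ 4 * (n : ℝ) ^ 2 * (L + l₁) := mul_le_mul_of_nonneg_left hlog2 (by positivity)
  have hn2 : 0 ≤ (n : ℝ) ^ 2 := by positivity
  have h7 : 7 * (n : ℝ) ^ 2 ≤ 7 * (n : ℝ) ^ 2 * L :=
    le_mul_of_one_le_right (by positivity) hL1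
  have h8 : 4 * (n : ℝ) ^ 2 * l₁ ≤ 4 * (n : ℝ) ^ 2 * l₁ * L :=
    le_mul_of_one_le_right (by positivity) hL1
  have h9 : (n : ℝ) ^ 2 * M ≤ (n : ℝ) ^ 2 * M * L :=
    le_mul_of_one_le_right (by positivity) hL1
  have hexp : (11 + 4 * l₁ + M) * (n : ℝ) ^ 2 * L =
      7 * (n : ℝ) ^ 2 * L + 4 * (n : ℝ) ^ 2 * L + 4 * (n : ℝ) ^ 2 * l₁ * L +
        (n : ℝ) ^ 2 * M * L := by ring
  linarith

/-! ## The core lemma: Proposition 3.1 at `t = 1` for a coprime primitive pair -/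

/-- **Roy's Proposition 3.1 at `t = 1` for a coprime pair of primitive polynomials.**
If `F, G ∈ ℤ[X]` are nonzero, primitive, with `gcd F G = 1`, of degrees `≤ n`, `E` is a set
of `s` points, `0 < s ≤ n`, and `V z` bounds both `‖F(z)‖ / ‖F‖` and `‖G(z)‖ / ‖G‖`
on `E`, then `1 ≤ c₁ (n, s, 1, E) · ‖F‖ ^ (deg G) · ‖G‖ ^ (deg F) · ∏_{z ∈ E} V z`. -/
theorem soloX_p31_coprime (hP31 : prop_3_1) {F G : ℤ[X]} (hF : F ≠ 0) (hG : G ≠ 0)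
    (hFp : F.IsPrimitive) (hGp : G.IsPrimitive) (hgcd : gcd F G = 1) {s n : ℕ} (hs : 0 < s)
    (hsn : s ≤ n) (hFn : F.natDegree ≤ n) (hGn : G.natDegree ≤ n) {E : Finset ℂ}
    (hE : E.card = s) {V : ℂ → ℝ}
    (hV : ∀ z ∈ E,
      ‖aeval z F‖ / F.supNorm ≤ V z ∧ ‖aeval z G‖ / G.supNorm ≤ V z) :
    1 ≤ c₁ n s 1 E * F.supNorm ^ G.natDegree * G.supNorm ^ F.natDegree * ∏ z ∈ E, V z := by
  have hn : 0 < n := lt_of_lt_of_le hs hsn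
  have h := hP31 n s 1 hn hs one_pos (by rw [mul_one]; exact hsn) E hE F G hF hG hFp hGp
    hFn hGn F.natDegree G.natDegree (Nat.sub_le _ _) hFn (Nat.sub_le _ _) hGn V
    (fun z hz j hj => by
      have hj0 : j = 0 := by omega
      subst hj0
      simpa only [hasseDeriv_zero'] using hV z hz)
  have h1 : (1 : ℤ[X]).supNorm = 1 := by rw [← C_1, supNorm_C, norm_one]
  rw [hgcd, h1] at h
  simpa only [one_pow, map_one, norm_one, div_one, Finset.prod_const_one, one_mul, pow_one,
    mul_one] using h

/-- For positive reals `a, b` and `c, d ≥ 1`: `log (max (a / c) (b / d)) ≤ max (log a) (log b)`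
(the normalised quotients of Proposition 3.1 against the raw values). -/
theorem soloX_log_max_div_le {a b c d : ℝ} (ha : 0 < a) (hb : 0 < b) (hc : 1 ≤ c)
    (hd : 1 ≤ d) : Real.log (max (a / c) (b / d)) ≤ max (Real.log a) (Real.log b) := by
  have hac : a / c ≤ a := div_le_self ha.le hc
  have hbd : b / d ≤ b := div_le_self hb.le hd
  have hpos : 0 < max (a / c) (b / d) := lt_max_of_lt_left (div_pos ha (by linarith))
  rcases le_total (a / c) (b / d) with h | h
  · rw [max_eq_right h]
    exact (Real.log_le_log (div_pos hb (by linarith)) hbd).trans (le_max_right _ _)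
  · rw [max_eq_left h]
    exact (Real.log_le_log (div_pos ha (by linarith)) hac).trans (le_max_left _ _)

end Summit.Schanuel.Schanuel.Theorems
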